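import Summits.HodgeConjecture.CorCM.DihedralReflexPairCMHodge
import Summits.HodgeConjecture.CorCM.CMFamilyRankClosureBound
import Summits.HodgeConjecture.CorCM.QuarticCMSameFieldPairs
import Literature.AlgebraicGeometry.Pohlmann1968.CMFamilyRankSubfamilies
import HarnessLib

/-!
# The dihedral surface triple has rank EXACTLY `5`: every family of CM types inside one dihedral octic closure that
# contains a reflex pair has `cmFamilyRank = 5 = rank of the pair` (the further surfaces add no Mumford–Tate directions)

COR-CM (cell `pub-hodgecm2`, seat p2 gen 19, count-neutral claim DIHEDRAL-TRIPLE, sequel); NEW as stated, hence under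
`Summits/`.  Theorems only; no definition, no named fact, no `sorry`.

For a non-Galois quartic CM field `K` with Galois closure `L ⊂ ℂ` (`[L:ℚ] = 8`, dihedral) and its reflex-class partner
`M` (`Hom(M, ℂ) ⊆ L`, `Hom(M, K) = ∅`, `M/ℚ` not Galois), the PAIR `(K, Φ), (M, Ψ)` is a nondegenerate family of rank
`5` (`DihedralReflexPair.cmFamilyRank_eq_five_of_dihedralReflexPair`: `Hg(S₁ × S₂) = Hg(S₁) × Hg(S₂)`).  Here: ANY
family `(K_i, Φ_i)_{i ∈ I}` of CM types all of whose complex embeddings land in `L` and which contains such a pair at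
two indices `i₀ ≠ i₁` has rank EXACTLY `5`:
* `≤ 5 = [L:ℚ]/2 + 1` is the closure bound (`CMFamilyRankClosureBound.cmFamilyRank_le_finrank_div_two_add_one`);
* `≥ 5` because the rank of a family bounds the rank of every sub-family
  (`Pohlmann1968.CMAlgebra.cmFamilyRank_comp_le`, pulled back along `![i₀, i₁] : Fin 2 → I`).
So the Mumford–Tate group of `S₁ × S₂ × S₁′` (and of the four-factor core `S₁ × S₂ × S₁′ × S₂′`, and of any product
of CM abelian varieties with CM inside `L` containing `S₁ × S₂`) has the dimension `5` of that of `S₁ × S₂`: the periods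
of the further factors are governed by those of the pair — rank `5` against the nondegenerate value
`Σ_i [K_i:ℚ]/2 + 1` (`= 7` for the triple: defect `2`), which is the degeneracy behind the exceptional `(2,2)`-classes
of `DihedralReflexTripleCMHodge`.

* `cmFamilyRank_eq_five_of_pair_of_mem_normalClosure` (general index set);
* `cmFamilyRank_eq_five` (the triple over `Fin 3` with `e : K₂ ≃ K₀`), `cmFamilyRank_eq_cmFamilyRank_pair`.

## References
* [Gordon1999HodgeAVSurvey] B. B. Gordon, *A survey of the Hodge conjecture for abelian varieties*, 7.5–7.7.
* [MoonenZarhin1999LowDim] B. Moonen, Yu. Zarhin, *Hodge classes on abelian varieties of low dimension*, Math. Ann. 315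
  (1999) 711–733, "Hodge groups of simple abelian surfaces of CM-type".
* [Deligne1982HodgeCycles] P. Deligne, *Hodge cycles on abelian varieties*, LNM 900 (1982), I Ex. 3.7 (c)–(d).
-/

noncomputable section

open NumberField NumberField.ComplexEmbedding IntermediateField
open scoped BigOperators

namespace Summit.HodgeConjecture.CorCM

open Literature.NumberTheory.ComplexMultiplication
open Literature.AlgebraicGeometry.Motives (CMType)
open Literature.AlgebraicGeometry.Pohlmann1968
open QuarticCMPairs

namespace DihedralReflexTriple

/-! ### Rank `5` for every family inside the dihedral closure containing a reflex pair -/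

section General

variable {I : Type} {K : I → Type} [∀ i, Field (K i)] [∀ i, NumberField (K i)] [∀ i, IsCMField (K i)] [Fintype I]

/-- **Rank exactly `5`.**  A family of CM types `(K_i, Φ_i)_{i∈I}` all of whose complex embeddings land in the Galois
closure `L` of the non-Galois quartic CM field `K_{i₀}`, and which at `i₀, i₁` contains a reflex pair (`K_{i₁}` non-Galois
quartic CM with `Hom(K_{i₁}, ℂ) ⊆ L`, `Hom(K_{i₁}, K_{i₀}) = ∅`), has `cmFamilyRank Φ = 5`: at most `[L:ℚ]/2 + 1 = 5` by the
closure bound, at least the rank `5` of the sub-pair.  On Mumford–Tate groups: `dim MT(∏_i A_i) = dim MT(A_{i₀} × A_{i₁}) = 5`.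
[cite: Gordon1999HodgeAVSurvey, 7.5–7.7] [cite: MoonenZarhin1999LowDim, "Hodge groups of simple abelian surfaces of
CM-type"] -/
theorem cmFamilyRank_eq_five_of_pair_of_mem_normalClosure {i₀ i₁ : I}
    (h4₀ : Module.finrank ℚ (K i₀) = 4) (hK₀ : ¬IsGalois ℚ (K i₀)) (h4₁ : Module.finrank ℚ (K i₁) = 4)
    (hK₁ : ¬IsGalois ℚ (K i₁)) (hMK : ∀ (t : K i₁ →+* ℂ) (y : K i₁), t y ∈ normalClosure ℚ (K i₀) ℂ)
    (hne : IsEmpty (K i₁ →+* K i₀))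
    (hL : ∀ (i : I) (s : K i →+* ℂ) (y : K i), s y ∈ normalClosure ℚ (K i₀) ℂ) (Φ : ∀ i, CMType (K i)) :
    CMAlgebra.cmFamilyRank Φ = 5 := by
  haveI : Nonempty I := ⟨i₀⟩
  refine le_antisymm ?_ ?_
  · have h := cmFamilyRank_le_finrank_div_two_add_one Φ (normalClosure ℚ (K i₀) ℂ) hL
    rwa [finrank_normalClosure_complex_eq_eight i₀ h4₀ hK₀] at h
  · -- the sub-pair `![i₀, i₁] : Fin 2 → I` has rank `5`
    let π : Fin 2 → I := ![i₀, i₁]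
    have hI : ∀ j : Fin 2, j = 0 ∨ j = 1 := by decide
    have h5 : CMAlgebra.cmFamilyRank (fun j => Φ (π j)) = 5 :=
      DihedralReflexPair.cmFamilyRank_eq_five_of_dihedralReflexPair (K := fun j => K (π j)) (i₀ := 0) (i₁ := 1)
        hI (by decide) h4₀ hK₀ h4₁ hK₁ hMK hne fun j => Φ (π j)
    rw [← h5]
    exact CMAlgebra.cmFamilyRank_comp_le Φ π

end General

/-! ### The triple `(K₀, K₁, K₂ ≃ K₀)` over `Fin 3` -/

section Triple

variable {K : Fin 3 → Type} [∀ j, Field (K j)] [∀ j, NumberField (K j)] [∀ j, IsCMField (K j)]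

/-- **`rank(S₁ × S₂ × S₁′) = 5`** for the dihedral surface triple: `K₀` non-Galois quartic CM, `K₁` its reflex-class
partner, `K₂ ≃ K₀`; any types.  (Nondegenerate value: `12/2 + 1 = 7`; defect `2`.) [cite: Gordon1999HodgeAVSurvey, 7.5–7.7]
[cite: MoonenZarhin1999LowDim, "Hodge groups of simple abelian surfaces of CM-type"] -/
theorem cmFamilyRank_eq_five (h4₀ : Module.finrank ℚ (K 0) = 4) (hK₀ : ¬IsGalois ℚ (K 0))
    (h4₁ : Module.finrank ℚ (K 1) = 4) (hK₁ : ¬IsGalois ℚ (K 1))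
    (hMK : ∀ (t : K 1 →+* ℂ) (y : K 1), t y ∈ normalClosure ℚ (K 0) ℂ) (hne : IsEmpty (K 1 →+* K 0))
    (e : K 2 ≃+* K 0) (Φ : ∀ j, CMType (K j)) : CMAlgebra.cmFamilyRank Φ = 5 := by
  refine cmFamilyRank_eq_five_of_pair_of_mem_normalClosure (i₀ := (0 : Fin 3)) (i₁ := 1) h4₀ hK₀ h4₁ hK₁ hMK hne
    (fun j s y => ?_) Φ
  fin_cases j
  · exact s.toRatAlgHom.fieldRange_le_normalClosure ⟨y, rfl⟩
  · exact hMK s y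
  · obtain ⟨s', rfl⟩ := exists_eq_comp_ringEquiv e s
    exact s'.toRatAlgHom.fieldRange_le_normalClosure ⟨e y, rfl⟩

/-- **The third surface adds no Mumford–Tate directions**: the rank of the triple equals the rank `5` of the pair
`(K₀, Φ₀), (K₁, Φ₁)` (`Hg(S₁ × S₂ × S₁′)` is isogenous onto `Hg(S₁ × S₂) = Hg(S₁) × Hg(S₂)`), although `S₁′` is
isogenous to neither `S₁` nor `S₂`. [cite: MoonenZarhin1999LowDim, "Hodge groups of simple abelian surfaces of CM-type"]
[cite: Gordon1999HodgeAVSurvey, 7.5–7.7] -/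
theorem cmFamilyRank_eq_cmFamilyRank_pair (h4₀ : Module.finrank ℚ (K 0) = 4) (hK₀ : ¬IsGalois ℚ (K 0))
    (h4₁ : Module.finrank ℚ (K 1) = 4) (hK₁ : ¬IsGalois ℚ (K 1))
    (hMK : ∀ (t : K 1 →+* ℂ) (y : K 1), t y ∈ normalClosure ℚ (K 0) ℂ) (hne : IsEmpty (K 1 →+* K 0))
    (e : K 2 ≃+* K 0) (Φ : ∀ j, CMType (K j)) :
    CMAlgebra.cmFamilyRank Φ = CMAlgebra.cmFamilyRank (fun j : Fin 2 => Φ (Fin.castSucc j)) := by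
  have hI : ∀ j : Fin 2, j = 0 ∨ j = 1 := by decide
  rw [cmFamilyRank_eq_five h4₀ hK₀ h4₁ hK₁ hMK hne e Φ,
    DihedralReflexPair.cmFamilyRank_eq_five_of_dihedralReflexPair (K := fun j : Fin 2 => K (Fin.castSucc j))
      (i₀ := 0) (i₁ := 1) hI (by decide) h4₀ hK₀ h4₁ hK₁ hMK hne fun j => Φ (Fin.castSucc j)]

/-- **Defect `2`**: the nondegenerate value of the rank for the triple is `Σ_j [K_j:ℚ]/2 + 1 = 7`, two more than the
actual rank `5` (every PAIR has defect `0`). [cite: Gordon1999HodgeAVSurvey, 7.5–7.7] -/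
theorem sum_finrank_div_two_add_one_eq_cmFamilyRank_add_two (h4₀ : Module.finrank ℚ (K 0) = 4)
    (hK₀ : ¬IsGalois ℚ (K 0)) (h4₁ : Module.finrank ℚ (K 1) = 4) (hK₁ : ¬IsGalois ℚ (K 1))
    (hMK : ∀ (t : K 1 →+* ℂ) (y : K 1), t y ∈ normalClosure ℚ (K 0) ℂ) (hne : IsEmpty (K 1 →+* K 0))
    (e : K 2 ≃+* K 0) (Φ : ∀ j, CMType (K j)) :
    (∑ j, Module.finrank ℚ (K j)) / 2 + 1 = CMAlgebra.cmFamilyRank Φ + 2 := by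
  have h4₂ : Module.finrank ℚ (K 2) = 4 :=
    ((AlgEquiv.ofRingEquiv (f := e) fun q => by simp).toLinearEquiv.finrank_eq).trans h4₀
  rw [cmFamilyRank_eq_five h4₀ hK₀ h4₁ hK₁ hMK hne e Φ, Fin.sum_univ_three, h4₀, h4₁, h4₂]
  norm_num

end Triple

end DihedralReflexTriple

end Summit.HodgeConjecture.CorCM

end
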